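import Summits.ResolutionOfSingularities.ResolutionOfSingularities.Theorems.PurelyInseparableDim4StepKitState
import Mathlib.Algebra.CharP.Lemmas
import HarnessLib

/-!
# STEP KIT over `𝔽₄`: a COMPUTABLE four-element field for kernel certificates at `𝔽₄`-rational points

[OURS · instrument · counted 0.]  Census cell «res-dim4-pi» (D-0157 DOOR 2), TY-4 series / W3-2 kit
(res-dim4-p-4, offer (i) 17:24Z).  res-dim4-p-13's `StepKit` certifies edges of the tree's model
`CentreBlowup.step` by `decide` over any field with decidable equality whose arithmetic the kernel can
evaluate — in practice `ZMod p`.  The census' IRRATIONAL rises (J-001's six points, the 14 `𝔽₄` facts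
of the D ≤ 4 band, every `GF(4)` RISE:d of S-1a) live at `𝔽₄`-points, and Mathlib's `GaloisField 2 2`
is not computable.  This file supplies the missing ingredient: the four-element type
`F4 = {0, 1, ω, ω+1}` with its addition / multiplication / inverse TABLES and the `Field`, `CharP _ 2`,
`Fintype`, `DecidableEq` structure, every axiom checked by `decide` (64-case tables) — a NEW type, so no
Mathlib instance is overridden or duplicated — followed by the acceptance certificate: **J-001 at the
`𝔽₄`-point `(1, ω, ω²)` by `step0_of … (by decide)`** (the same edge `PurelyInseparableDim4ZooCertJ001`
proves symbolically for every field with a primitive cube root of unity).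
Nothing here proves or disproves resolution of singularities in dim ≥ 4 / char p.
-/

-- house layout `Summits/<Summit>/<Problem>` doubles the namespace component (as in the Target file)
set_option linter.dupNamespace false

namespace Summit.ResolutionOfSingularities.ResolutionOfSingularities.Theorems.PIDim4

namespace StepKit

/-! ## 1. The computable field `F4` -/

/-- The field with four elements, as a plain inductive type: `0, 1, ω, ω + 1` (`ω² = ω + 1`).
[folklore] -/
inductive F4 where
  | zero | one | om | om1
  deriving DecidableEq, Repr

namespace F4

/-- addition table (characteristic `2`). [folklore] -/
def add : F4 → F4 → F4
  | zero, b => b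
  | a, zero => a
  | one, one => zero | one, om => om1 | one, om1 => om
  | om, one => om1 | om, om => zero | om, om1 => one
  | om1, one => om | om1, om => one | om1, om1 => zero

/-- multiplication table (`ω·ω = ω+1`, `ω·(ω+1) = 1`, `(ω+1)² = ω`). [folklore] -/
def mul : F4 → F4 → F4
  | zero, _ => zero
  | _, zero => zero
  | one, b => b
  | a, one => a
  | om, om => om1 | om, om1 => one
  | om1, om => one | om1, om1 => om

/-- inverses (`ω⁻¹ = ω + 1`). [folklore] -/
def inv : F4 → F4
  | zero => zero | one => one | om => om1 | om1 => om

/-- `0`. [folklore] -/ instance : Zero F4 := ⟨zero⟩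
/-- `1`. [folklore] -/ instance : One F4 := ⟨one⟩
/-- `+`. [folklore] -/ instance : Add F4 := ⟨add⟩
/-- `*`. [folklore] -/ instance : Mul F4 := ⟨mul⟩
/-- `−` (the identity, characteristic `2`). [folklore] -/ instance : Neg F4 := ⟨id⟩
/-- `⁻¹`. [folklore] -/ instance : Inv F4 := ⟨inv⟩

/-- the four elements. [folklore] -/
instance : Fintype F4 := ⟨⟨{zero, one, om, om1}, by decide⟩, fun x => by cases x <;> decide⟩

/-- `F4` is a commutative ring (all axioms by `decide` on the tables). [folklore] -/
instance : CommRing F4 where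
  add_assoc := by decide
  zero_add := by decide
  add_zero := by decide
  nsmul := nsmulRec
  add_comm := by decide
  left_distrib := by decide
  right_distrib := by decide
  zero_mul := by decide
  mul_zero := by decide
  mul_assoc := by decide
  one_mul := by decide
  mul_one := by decide
  zsmul := zsmulRec
  neg_add_cancel := by decide
  mul_comm := by decide

/-- `F4` is a field. [folklore] -/
instance : Field F4 where
  exists_pair_ne := ⟨zero, one, by decide⟩
  mul_inv_cancel := by decide
  inv_zero := by decide
  nnqsmul := _
  qsmul := _

/-- `F4` has characteristic `2`. [folklore] -/
instance : CharP F4 2 := (CharP.charP_iff_prime_eq_zero Nat.prime_two).mpr (by decide)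

/-- `ω` is a primitive cube root of unity: `ω² + ω + 1 = 0`. [folklore] -/
theorem om_sq_add_om_add_one : (om : F4) ^ 2 + om + 1 = 0 := by decide

/-- `F4` has exactly four elements. [folklore] -/
theorem card_F4 : Fintype.card F4 = 4 := rfl

end F4

/-! ## 2. Acceptance certificate: J-001 at the `𝔽₄`-point `(1, ω, ω²)` -/

namespace J001F4

open F4

/-- the P-2-1 parent `a = (xy³vw + xyv³w + xyvw³, (1,1,1,1), all)` over `F4`. [folklore] -/
def a : SData 4 F4 := ⟨[(![1, 3, 1, 1], 1), (![1, 1, 3, 1], 1), (![1, 1, 1, 3], 1)], ![1, 1, 1, 1], {0, 1, 2, 3}⟩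

/-- the `𝔽₄`-point `(y, v, w) = (1, ω, ω²)` of the `x`-chart (`ω² = ω + 1`). [folklore] -/
def b : Fin 4 → F4 := ![0, 1, om, om1]

/-- the kangaroo child: the model's step, presented (21 monomials, coefficients in `F4`). [folklore] -/
def k : SData 4 F4 := stepD 2 Finset.univ 0 b a

/-- **J-001 at an `𝔽₄`-point is a MODE-0 step**, certified by `decide` over `F4`. [folklore] -/
theorem step0_a_k : Step0 2 a.toState k.toState :=
  step0_of 0 b (by decide) (by decide) (by decide) (by decide) (by decide)

/-- shades: `2` before, `3` after — the irrational kangaroo RISE. [folklore] -/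
theorem shade_a : a.toState.shade = 2 := by rw [shade_toState]; decide
/-- see `shade_a`. [folklore] -/
theorem shade_k : k.toState.shade = 3 := by rw [shade_toState]; decide
/-- **RISE:d `2 → 3` at the `𝔽₄`-point.** [folklore] -/
theorem riseD_a_k : RiseD a.toState k.toState := (riseD_iff a k).mpr (by decide)

end J001F4

end StepKit

open StepKit StepKit.J001F4 in
/-- **J-001 ‖ K over the computable `𝔽₄`**: a MODE-0 edge of class (4,1) at an `𝔽₄`-rational point
with shade `2 → 3` (the irrational kangaroo of P-2-1), by kernel evaluation. [folklore] -/
theorem exists_step0_riseD_F4 : ∃ s s' : State StepKit.F4, Step0 2 s s' ∧ s.shade = 2 ∧ s'.shade = 3 :=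
  ⟨a.toState, k.toState, step0_a_k, shade_a, shade_k⟩

end Summit.ResolutionOfSingularities.ResolutionOfSingularities.Theorems.PIDim4
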